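import Summits.BirchSwinnertonDyer.Rank1Residual.Additive.QuadraticTwistBSDComparison
import Literature.NumberTheory.EllipticCurves.ComplexMultiplicationBSDTripleIsogenyProofs
import Literature.NumberTheory.EllipticCurves.BSDInvariantsPositivityProofs
import Literature.NumberTheory.EllipticCurves.IsogenyDualInseparableProofs
import Literature.NumberTheory.EllipticCurves.BSDQuadraticDescent
import HarnessLib

/-!
# The twist-transport comparison statement — ISOGENY links are free (cell `b2b-bsdres`, team n1011, route (c), item T-c1, complement)

HONEST FRAMING (cell `b2b-bsdres`, run/shared/lean/b2b/bsd-rank1-residual/, verbatim in every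
file): the goal of the cell is to DELETE the COMBINATION-SHAPED residual classes of the
Birch–Swinnerton-Dyer formula for ALL analytic-rank `≤ 1` elliptic curves over `ℚ` — "full BSD
formula for every rank `≤ 1` curve in class `C`" assembled STRICTLY from published theorems — so
that the rank-`≤ 1` remainder becomes exactly the CONSTRUCTION-SHAPED classes, which are TYPED
(missing-input `Prop`s), NOT attempted. This is not "finishing BSD". Team n1011 (N10 / N11): prove
what is provable now; shrink each hard class to its core with data; no claim beyond stated classes;
research routes; census output = EVIDENCE / conjecture items, never a Literature fact.

Theorems only (no definition, no new named fact). Third file of item T-c1 (Layer A: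
`QuadraticTwistBSDComparison.lean`; Layer B: `QuadraticTwistBSDComparisonTwistPair.lean`). The E3
RELATIONS table of CLASS-CLOSURE-PLAN §1 item 5 has two kinds of links: quadratic twists (Layer B:
`BSDp` transports GIVEN the `Ш`-column) and ISOGENIES ("Cassels isogeny invariance (in kernel)").
This file records that isogeny links need NO given: for `ℚ`-isogenous globally minimal `W ∼ W'`
with `Ш(W)` finite, Cassels' theorem (`hCassels` = named fact
`WeierstrassCurve.bsdRHS_eq_of_isIsogenous`: the BSD quotient `#Ш·Reg·Ω·∏c/#tors²` is an isogeny
invariant; Cassels 1965, Milne ADT I.7.3) and `L(W,s) = L(W',s)` (Knapp Thm. 11.67, PROVED in the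
tree: `leadingLCoeff_eq_of_isIsogenous'`, `analyticRank_eq_of_isIsogenous'`) give
`#Ш_an(W')/#Ш(W') = #Ш_an(W)/#Ш(W)` (`shaAn_mul_shaOrder_eq_of_isIsogenous`), hence the comparison
statement `DefectAgreeAt W W' p` at EVERY `p` (`defectAgreeAt_of_isIsogenous`), hence — by Layer A's
transport — **Miller's `BSD(E,p)` is an isogeny invariant in analytic rank `≤ 1`**
(`bsdp_iff_bsdp_of_isIsogenous`; Miller 2011 §1 states the invariance and uses it to move to the
optimal curve; the tree's `BSDp` docstring recorded it as "not used here" — this is its kernel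
form, under the explicit binders Cassels `hCassels`, GZK `hGZK`, modularity `hmod`). Composability:
`defectAgreeAt_trans` chains isogeny links (free) with twist links (GIVEN the `Ш`-column), so a
RELATIONS row may be taken between ANY members of the two isogeny classes. Moves no mark; closes
no pair by itself.

References: Cassels 1965 [Cassels1965ArithmeticVIII]; Milne ADT [MilneADT2006] Thm. I.7.3;
Knapp [Knapp1993] Thm. 11.67; Miller 2011 [Miller2011LMS] §1, Def. 1.1; Darmon 2004 [Darmon2004]
Thm. 3.22.
-/

noncomputable section

open scoped Classical

open WeierstrassCurve Literature.NumberTheory.EllipticCurves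
  Literature.NumberTheory.EllipticCurves.Rank1Residual
  Literature.NumberTheory.EllipticCurves.Rank1Residual.Typed

namespace Summit.BirchSwinnertonDyer.Rank1Residual.Additive

namespace TwistComparison

variable (W W' : WeierstrassCurve ℚ) [W.IsElliptic] [W'.IsElliptic] (p : ℕ)

omit [W'.IsElliptic] in
/-- `#Ш_an(W) · (BSD right-hand side of W) = L^{(r)}(W,1)/r! · #Ш(W)`: the analytic order of `Ш`
times Tate's quotient `#Ш·Reg·Ω·∏c/#tors²` is the leading coefficient times `#Ш` (the factors
`Reg, Ω, ∏c, #tors` cancel; all are nonzero for an elliptic `W`). Bookkeeping from `shaAn_def` and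
`bsdRHS`. [folklore] -/
theorem shaAn_mul_bsdRHS :
    shaAn W * ((W.bsdRHS : ℝ) : ℂ) = W.leadingLCoeff * (W.shaOrder : ℂ) := by
  have hΩ : (W.realPeriodRat : ℂ) ≠ 0 := by exact_mod_cast W.realPeriodRat_pos_holds.ne'
  have hR : (W.regulator : ℂ) ≠ 0 := by exact_mod_cast W.regulator_pos'.ne'
  have hc : (W.tamagawaProduct : ℂ) ≠ 0 := by exact_mod_cast W.tamagawaProduct_pos_holds.ne'
  have ht : (W.torsionOrder : ℂ) ≠ 0 := by exact_mod_cast W.torsionOrder_pos_holds.ne'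
  rw [shaAn_def, WeierstrassCurve.bsdRHS]
  push_cast
  field_simp

/-- **`#Ш_an` scales like `#Ш` under a `ℚ`-isogeny**: for globally minimal `W ∼ W'` with `Ш(W)`
finite, `#Ш_an(W') · #Ш(W) = #Ш_an(W) · #Ш(W')`. From Cassels' isogeny invariance of the BSD
quotient (`hCassels`, named fact `bsdRHS_eq_of_isIsogenous`; it also yields `Ш(W')` finite) and the
equality of leading coefficients (`leadingLCoeff_eq_of_isIsogenous'`, Knapp 11.67, proved).
[cite: Cassels1965ArithmeticVIII] [cite: MilneADT2006, Thm. I.7.3 and Remark I.7.4]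
[cite: Knapp1993, Thm. 11.67] -/
theorem shaAn_mul_shaOrder_eq_of_isIsogenous [W.IsGloballyMinimal] [W'.IsGloballyMinimal]
    (hCassels : bsdRHS_eq_of_isIsogenous) (hiso : IsIsogenous W W') (hfin : W.ShaFinite) :
    shaAn W' * (W.shaOrder : ℂ) = shaAn W * (W'.shaOrder : ℂ) := by
  obtain ⟨hfin', hB⟩ := hCassels W W' hiso hfin
  have hBpos : 0 < W.bsdRHS := W.bsdRHS_pos' hfin
  have hB0 : ((W.bsdRHS : ℝ) : ℂ) ≠ 0 := by exact_mod_cast hBpos.ne'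
  have h1 := shaAn_mul_bsdRHS W
  have h2 := shaAn_mul_bsdRHS W'
  rw [hB, ← leadingLCoeff_eq_of_isIsogenous' hiso] at h2
  -- `shaAn W' · B = L* · #Ш(W')`, `shaAn W · B = L* · #Ш(W)`; eliminate `B`
  have key : shaAn W' * (W.shaOrder : ℂ) * ((W.bsdRHS : ℝ) : ℂ) =
      shaAn W * (W'.shaOrder : ℂ) * ((W.bsdRHS : ℝ) : ℂ) := by
    calc shaAn W' * (W.shaOrder : ℂ) * ((W.bsdRHS : ℝ) : ℂ)
        = (shaAn W' * ((W.bsdRHS : ℝ) : ℂ)) * (W.shaOrder : ℂ) := by ring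
      _ = W.leadingLCoeff * (W'.shaOrder : ℂ) * (W.shaOrder : ℂ) := by rw [h2]
      _ = (W.leadingLCoeff * (W.shaOrder : ℂ)) * (W'.shaOrder : ℂ) := by ring
      _ = (shaAn W * ((W.bsdRHS : ℝ) : ℂ)) * (W'.shaOrder : ℂ) := by rw [h1]
      _ = shaAn W * (W'.shaOrder : ℂ) * ((W.bsdRHS : ℝ) : ℂ) := by ring
  exact mul_right_cancel₀ hB0 key

variable [Fact p.Prime]

/-- **Isogeny links are free: `DefectAgreeAt W W' p` at every prime `p`** for globally minimal
`ℚ`-isogenous `W ∼ W'` with `Ш(W)` finite and `#Ш_an(W) = q ∈ ℚ` (then `#Ш_an(W') = q·#Ш(W')/#Ш(W)`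
and `δ_p(W') = δ_p(W)`; `q ≠ 0` by modularity `hmod`: `L^{(r)}(W,1) ≠ 0`). Binders: Cassels
`hCassels`, modularity `hmod`. [cite: Cassels1965ArithmeticVIII] [cite: MilneADT2006, Thm. I.7.3]
[cite: Miller2011LMS, §1] -/
theorem defectAgreeAt_of_isIsogenous [W.IsGloballyMinimal] [W'.IsGloballyMinimal]
    (hCassels : bsdRHS_eq_of_isIsogenous) (hmod : hasEntireLFunction_rat)
    (hiso : IsIsogenous W W') (hfin : W.ShaFinite) {q : ℚ} (hq : shaAn W = (q : ℂ)) :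
    DefectAgreeAt W W' p := by
  obtain ⟨hfin', -⟩ := hCassels W W' hiso hfin
  have hS : 0 < W.shaOrder := W.shaOrder_pos hfin
  have hS' : 0 < W'.shaOrder := W'.shaOrder_pos hfin'
  have hSc : (W.shaOrder : ℂ) ≠ 0 := by exact_mod_cast hS.ne'
  -- `q ≠ 0`
  have hq0 : q ≠ 0 := by
    rintro rfl
    have h1 := shaAn_mul_bsdRHS W
    rw [hq, Rat.cast_zero, zero_mul] at h1
    have hL : W.leadingLCoeff ≠ 0 := W.leadingLCoeff_ne_zero_holds (hmod W)
    exact mul_ne_zero hL hSc h1.symm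
  -- `#Ш_an(W') = q · #Ш(W') / #Ш(W)`
  have hkey := shaAn_mul_shaOrder_eq_of_isIsogenous W W' hCassels hiso hfin
  have hq' : shaAn W' = ((q * (W'.shaOrder : ℚ) / (W.shaOrder : ℚ) : ℚ) : ℂ) := by
    rw [hq] at hkey
    push_cast
    rw [eq_div_iff hSc, hkey]
  refine ⟨q, q * (W'.shaOrder : ℚ) / (W.shaOrder : ℚ), hq, hq', ?_⟩
  have hSq : (W.shaOrder : ℚ) ≠ 0 := by exact_mod_cast hS.ne'
  have hSq' : (W'.shaOrder : ℚ) ≠ 0 := by exact_mod_cast hS'.ne'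
  rw [padicValRat.div (mul_ne_zero hq0 hSq') hSq, padicValRat.mul hq0 hSq', padicValRat.of_nat,
    padicValRat.of_nat]
  ring

/-- **Miller's `BSD(E,p)` is an isogeny invariant in analytic rank `≤ 1`** (one direction): for
globally minimal `ℚ`-isogenous `W ∼ W'` with `ord_{s=1} L(W,s) ≤ 1`, `BSDp W p → BSDp W' p`.
Gross–Zagier–Kolyvagin (`hGZK`) gives `rank = r_an` and finite `Ш` on both sides (the analytic
ranks agree, `analyticRank_eq_of_isIsogenous'`); `BSDp W p` supplies the rational `#Ш_an(W)`;
Cassels (`hCassels`) makes the pair compare (`defectAgreeAt_of_isIsogenous`); Layer A transports.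
Miller 2011 §1: "`BSD(E,p)` is an isogeny invariant (Cassels)". [cite: Miller2011LMS, §1 and Def. 1.1]
[cite: Cassels1965ArithmeticVIII] [cite: Darmon2004, Thm. 3.22] -/
theorem bsdp_of_bsdp_of_isIsogenous [W.IsGloballyMinimal] [W'.IsGloballyMinimal]
    (hCassels : bsdRHS_eq_of_isIsogenous) (hGZK : rank_eq_analyticRank_of_analyticRank_le_one)
    (hmod : hasEntireLFunction_rat) (hiso : IsIsogenous W W') (hr : W.analyticRank ≤ 1)
    (h : BSDp W p) : BSDp W' p := by
  have hr' : W'.analyticRank ≤ 1 := by rw [← analyticRank_eq_of_isIsogenous' hiso]; exact hr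
  have hfin : W.ShaFinite := (hGZK W hr).2
  obtain ⟨-, -, q, hq, -⟩ := id h
  exact (bsdp_iff_bsdp_of_defectAgreeAt W W' p hGZK hr hr'
    (defectAgreeAt_of_isIsogenous W W' p hCassels hmod hiso hfin hq)).mp h

/-- **Miller's `BSD(E,p)` is an isogeny invariant in analytic rank `≤ 1`**: for globally minimal
`ℚ`-isogenous elliptic curves `W ∼ W'` with `ord_{s=1} L(W,s) ≤ 1`, `BSDp W p ↔ BSDp W' p`
(Cassels `hCassels`, GZK `hGZK`, modularity `hmod`; isogeny symmetric by
`IsIsogenous.symm_of_isElliptic`). The kernel form of Miller 2011 §1 "BSD(E,p) is an isogeny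
invariant"; in the RELATIONS table isogeny links therefore carry no GIVEN.
[cite: Miller2011LMS, §1 and Def. 1.1] [cite: Cassels1965ArithmeticVIII] [cite: Darmon2004, Thm. 3.22] -/
theorem bsdp_iff_bsdp_of_isIsogenous [W.IsGloballyMinimal] [W'.IsGloballyMinimal]
    (hCassels : bsdRHS_eq_of_isIsogenous) (hGZK : rank_eq_analyticRank_of_analyticRank_le_one)
    (hmod : hasEntireLFunction_rat) (hiso : IsIsogenous W W') (hr : W.analyticRank ≤ 1) :
    BSDp W p ↔ BSDp W' p := by
  have hr' : W'.analyticRank ≤ 1 := by rw [← analyticRank_eq_of_isIsogenous' hiso]; exact hr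
  exact ⟨bsdp_of_bsdp_of_isIsogenous W W' p hCassels hGZK hmod hiso hr,
    bsdp_of_bsdp_of_isIsogenous W' W p hCassels hGZK hmod hiso.symm_of_isElliptic hr'⟩

/-- The typed halves are isogeny invariants too (rank `≤ 1`): `MissingLowerBoundAt` transports
along a `ℚ`-isogeny of globally minimal curves, given the rational `#Ш_an(W)`.
[cite: Miller2011LMS, §1 and Def. 1.1] [cite: Cassels1965ArithmeticVIII] -/
theorem missingLowerBoundAt_of_isIsogenous [W.IsGloballyMinimal] [W'.IsGloballyMinimal]
    (hCassels : bsdRHS_eq_of_isIsogenous) (hGZK : rank_eq_analyticRank_of_analyticRank_le_one)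
    (hmod : hasEntireLFunction_rat) (hiso : IsIsogenous W W') (hr : W.analyticRank ≤ 1)
    (h : MissingLowerBoundAt W p) : MissingLowerBoundAt W' p := by
  have hfin : W.ShaFinite := (hGZK W hr).2
  obtain ⟨q, hq, hle⟩ := h
  obtain ⟨r, r', hr0, hr', hδ⟩ := defectAgreeAt_of_isIsogenous W W' p hCassels hmod hiso hfin hq
  have hrq : r = q := by exact_mod_cast hr0.symm.trans hq
  subst hrq
  exact ⟨r', hr', by omega⟩

/-- `MissingUpperBoundAt` transports along a `ℚ`-isogeny likewise.
[cite: Miller2011LMS, §1 and Def. 1.1] [cite: Cassels1965ArithmeticVIII] -/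
theorem missingUpperBoundAt_of_isIsogenous [W.IsGloballyMinimal] [W'.IsGloballyMinimal]
    (hCassels : bsdRHS_eq_of_isIsogenous) (hGZK : rank_eq_analyticRank_of_analyticRank_le_one)
    (hmod : hasEntireLFunction_rat) (hiso : IsIsogenous W W') (hr : W.analyticRank ≤ 1)
    (h : MissingUpperBoundAt W p) : MissingUpperBoundAt W' p := by
  have hfin : W.ShaFinite := (hGZK W hr).2
  obtain ⟨q, hq, hle⟩ := h
  obtain ⟨r, r', hr0, hr', hδ⟩ := defectAgreeAt_of_isIsogenous W W' p hCassels hmod hiso hfin hq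
  have hrq : r = q := by exact_mod_cast hr0.symm.trans hq
  subst hrq
  exact ⟨r', hr', by omega⟩

end TwistComparison

end Summit.BirchSwinnertonDyer.Rank1Residual.Additive

end
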